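import Summits.Parity.GeneralizedHardyLittlewood.Theorems.FordMaynardSieveConst01651SieveConst01651Grid
import Summits.Parity.GeneralizedHardyLittlewood.Theorems.FordMaynardSieveConst01651SieveConst01651ConeStep
import HarnessLib

/-!
# Route `FordMaynardSieveConst01651`, target `SieveConst01651` (stmt-Parity-19185), stub `stub_coneCertClosed`,
# conjunct (i) for the witness `coneCert`: the FACE part and the trivial dimensions

Def-free helper file.  Towards `IsPiecewiseConstOnCone coneCert` (conjunct (i)): representations on the ordered cone
(in the literal `∃ m P c, …` form of `…ConeStep`) of

* `gFace r` for `1 ≤ r ≤ 3` (`coneRep_gFace`): `−64 × #face conditions` is the sum, over coordinates `i` and edges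
  `e_a`, over index pairs `i < j` and the two band values, and (r = 3) the total `1/2`, of `−64 ×` the indicator of the
  face polytope `R_r ∩ {ℓ(x) = s}` (`R_r` = closed support region ∩ cone; `isConvexPolytope_region_inter_level`);
* `coneCert 0 ≡ 1`, `coneCert 1`, and `coneCert r ≡ 0` for `r ≥ 4` (`coneRep_coneCert_zero/one/four_le`).

The table parts of dimensions `2` and `3` (pieces indexed by all cell/band triples, values `g2Lookup`/`g3Lookup`,
collapse by `cellIdx_eq_of_mem_cell`) are the remaining half of conjunct (i).

References: [FordMaynard2024PrimeSieves] arXiv:2407.14368, Definitions 5.7, 7.2.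
-/

noncomputable section

open Finset
open scoped Classical
open Literature.NumberTheory.Sieve Literature.NumberTheory.Sieve.FordMaynard

namespace Summit.Parity.GeneralizedHardyLittlewood.FordMaynardSieveConst01651SieveConst01651

/-! ### Face polytopes: the closed support region cut by one level set -/

/-- For any linear form `ℓ(x) = ∑ vᵢ xᵢ` and level `s`, the set
`{x monotone, xᵢ > ν₀ ∀ i, |x| ≤ 1/2} ∩ {ℓ(x) = s}` is a convex polytope inside the ordered cone.
[cite: FordMaynard2024PrimeSieves, Definitions 5.7 and 7.2] -/
theorem isConvexPolytope_region_inter_level (r : ℕ) (v : Fin r → ℝ) (s : ℝ) :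
    IsConvexPolytope ({x : Fin r → ℝ | Monotone x ∧ (∀ i, (1651 / 10000 : ℝ) < x i) ∧ ∑ i, x i ≤ 1 / 2} ∩
        {x | ∑ i, v i * x i = s}) ∧
      ({x : Fin r → ℝ | Monotone x ∧ (∀ i, (1651 / 10000 : ℝ) < x i) ∧ ∑ i, x i ≤ 1 / 2} ∩
        {x | ∑ i, v i * x i = s}) ⊆ {x | Monotone x} := by
  -- `Q` = the same constraints without monotonicity; the target set is `Q ∩ cone`
  set Q : Set (Fin r → ℝ) := {x | (∀ i, (1651 / 10000 : ℝ) < x i) ∧ ∑ i, x i ≤ 1 / 2 ∧ ∑ i, v i * x i = s}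
    with hQ
  have hQpoly : IsConvexPolytope Q := by
    refine isConvexPolytope_of_constraints (ι₁ := Fin r) (ι₂ := Fin 3)
      (fun i l => if l = i then -1 else 0) (fun _ => -(1651 / 10000))
      (fun m => if m = 0 then (fun _ => 1) else if m = 1 then v else fun l => -v l)
      (fun m => if m = 0 then 1 / 2 else if m = 1 then s else -s) ?_ fun x => ?_
    · -- bounded: inside the box `[ν₀, 1/2]^r`
      refine (Metric.isBounded_Icc (fun _ : Fin r => (1651 / 10000 : ℝ)) (fun _ => 1 / 2)).subset ?_
      intro x hx
      simp only [hQ, Set.mem_setOf_eq] at hx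
      refine ⟨fun i => (hx.1 i).le, fun i => ?_⟩
      have : x i ≤ ∑ l, x l :=
        Finset.single_le_sum (fun l _ => (lt_trans (by norm_num) (hx.1 l)).le) (Finset.mem_univ i)
      exact this.trans hx.2.1
    · simp only [hQ, Set.mem_setOf_eq]
      have h1 : ∀ i : Fin r, ∑ l, (if l = i then (-1 : ℝ) else 0) * x l = -x i := by
        intro i; simp [Finset.sum_ite_eq']
      have h2 : ∑ l, (1 : ℝ) * x l = ∑ l, x l := by simp
      have h3 : ∑ l, (-v l) * x l = -∑ l, v l * x l := by
        rw [← Finset.sum_neg_distrib]; refine Finset.sum_congr rfl fun l _ => by ring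
      constructor
      · rintro ⟨hb, hs, hl⟩
        refine ⟨fun i => by rw [h1]; linarith [hb i], fun m => ?_⟩
        fin_cases m
        · simp only [Fin.zero_eta, Fin.isValue, ↓reduceIte]; rw [h2]; exact hs
        · simp only [Fin.mk_one, Fin.isValue, one_ne_zero, ↓reduceIte]; rw [hl]
        · simp only [Fin.reduceFinMk, Fin.isValue, Fin.reduceEq, ↓reduceIte]; rw [h3, hl]
      · rintro ⟨hb, hm⟩
        have hm0 := hm 0; have hm1 := hm 1; have hm2 := hm 2
        simp only [Fin.isValue, ↓reduceIte] at hm0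
        simp only [Fin.isValue, one_ne_zero, ↓reduceIte] at hm1
        simp only [Fin.isValue, Fin.reduceEq, ↓reduceIte] at hm2
        rw [h2] at hm0; rw [h3] at hm2
        refine ⟨fun i => ?_, hm0, le_antisymm hm1 (by linarith)⟩
        have := hb i; rw [h1] at this; linarith
  have hset : ({x : Fin r → ℝ | Monotone x ∧ (∀ i, (1651 / 10000 : ℝ) < x i) ∧ ∑ i, x i ≤ 1 / 2} ∩
      {x | ∑ i, v i * x i = s}) = Q ∩ {x | Monotone x} := by
    ext x; simp only [hQ, Set.mem_inter_iff, Set.mem_setOf_eq]; tauto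
  rw [hset]
  exact isConvexPolytope_inter_cone hQpoly

/-- The coordinate face `R_r ∩ {xᵢ = t}` is a convex polytope in the cone. [cite: FordMaynard2024PrimeSieves, Definition 7.2] -/
theorem isConvexPolytope_region_coord (r : ℕ) (i : Fin r) (t : ℝ) :
    IsConvexPolytope ({x : Fin r → ℝ | Monotone x ∧ (∀ i, (1651 / 10000 : ℝ) < x i) ∧ ∑ i, x i ≤ 1 / 2} ∩
        {x | x i = t}) ∧
      ({x : Fin r → ℝ | Monotone x ∧ (∀ i, (1651 / 10000 : ℝ) < x i) ∧ ∑ i, x i ≤ 1 / 2} ∩ {x | x i = t}) ⊆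
        {x | Monotone x} := by
  have h : {x : Fin r → ℝ | x i = t} = {x | ∑ l, (if l = i then (1 : ℝ) else 0) * x l = t} := by
    ext x; simp [Finset.sum_ite_eq']
  rw [h]; exact isConvexPolytope_region_inter_level r _ t

/-- The pair face `R_r ∩ {xᵢ + xⱼ = s}` (`i ≠ j`) is a convex polytope in the cone. [cite: FordMaynard2024PrimeSieves, Definition 7.2] -/
theorem isConvexPolytope_region_pair (r : ℕ) {i j : Fin r} (hij : i ≠ j) (s : ℝ) :
    IsConvexPolytope ({x : Fin r → ℝ | Monotone x ∧ (∀ i, (1651 / 10000 : ℝ) < x i) ∧ ∑ i, x i ≤ 1 / 2} ∩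
        {x | x i + x j = s}) ∧
      ({x : Fin r → ℝ | Monotone x ∧ (∀ i, (1651 / 10000 : ℝ) < x i) ∧ ∑ i, x i ≤ 1 / 2} ∩ {x | x i + x j = s}) ⊆
        {x | Monotone x} := by
  have h : {x : Fin r → ℝ | x i + x j = s} =
      {x | ∑ l, (if l = i ∨ l = j then (1 : ℝ) else 0) * x l = s} := by
    ext x
    simp only [Set.mem_setOf_eq]
    have : ∑ l, (if l = i ∨ l = j then (1 : ℝ) else 0) * x l = x i + x j := by
      rw [Finset.sum_eq_add_of_mem i j (Finset.mem_univ _) (Finset.mem_univ _) hij]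
      · simp
      · intro l _ hl; simp [hl.1, hl.2]
    rw [this]
  rw [h]; exact isConvexPolytope_region_inter_level r _ s

/-- The total face `R_r ∩ {|x| = s}` is a convex polytope in the cone. [cite: FordMaynard2024PrimeSieves, Definition 7.2] -/
theorem isConvexPolytope_region_total (r : ℕ) (s : ℝ) :
    IsConvexPolytope ({x : Fin r → ℝ | Monotone x ∧ (∀ i, (1651 / 10000 : ℝ) < x i) ∧ ∑ i, x i ≤ 1 / 2} ∩
        {x | ∑ i, x i = s}) ∧
      ({x : Fin r → ℝ | Monotone x ∧ (∀ i, (1651 / 10000 : ℝ) < x i) ∧ ∑ i, x i ≤ 1 / 2} ∩ {x | ∑ i, x i = s}) ⊆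
        {x | Monotone x} := by
  have h : {x : Fin r → ℝ | ∑ i, x i = s} = {x | ∑ l, (1 : ℝ) * x l = s} := by
    ext x; simp
  rw [h]; exact isConvexPolytope_region_inter_level r _ s

/-! ### Tools -/

/-- Distinct indices give distinct edges. [folklore] -/
theorem certEdge_cast_injOn {a b : ℕ} (ha : a ≤ 85) (hb : b ≤ 85)
    (h : ((certEdge a : ℚ) : ℝ) = ((certEdge b : ℚ) : ℝ)) : a = b := by
  by_contra hne
  rcases Nat.lt_or_gt_of_ne hne with hlt | hlt
  · exact absurd h (certEdge_cast_lt hlt hb).ne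
  · exact absurd h.symm (certEdge_cast_lt hlt ha).ne

/-- A sum of `c·𝟙` over a finset is `c × #` of the filter. [folklore] -/
theorem sum_ite_const_eq_card {ι : Type*} (s : Finset ι) (p : ι → Prop) [DecidablePred p] (c : ℝ) :
    ∑ i ∈ s, (if p i then c else 0) = c * ((s.filter p).card : ℝ) := by
  rw [← Finset.sum_filter, Finset.sum_const, nsmul_eq_mul, mul_comm]

/-- `coneRep_indicator` with the ambient decidability instance of the piece. [cite: FordMaynard2024PrimeSieves, Definition 7.2] -/
theorem coneRep_indicator' {k : ℕ} {Q : Set (Fin k → ℝ)} [DecidablePred (· ∈ Q)] (hQ : IsConvexPolytope Q)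
    (hQc : Q ⊆ {x | Monotone x}) (a : ℝ) :
    ∃ (m : ℕ) (P : Fin m → Set (Fin k → ℝ)) (c : Fin m → ℝ),
      (∀ j, IsConvexPolytope (P j) ∧ P j ⊆ {x | Monotone x}) ∧
        ∀ x : Fin k → ℝ, Monotone x → (if x ∈ Q then a else 0) = ∑ j, if x ∈ P j then c j else 0 := by
  refine ⟨1, fun _ => Q, fun _ => a, fun _ => ⟨hQ, hQc⟩, fun x _ => ?_⟩
  rw [Fin.sum_univ_one]
  by_cases h : x ∈ Q
  · rw [if_pos h, if_pos h]
  · rw [if_neg h, if_neg h]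

/-! ### `gFace r` is a finite sum of face-polytope indicators -/

/-- **`gFace r`, `1 ≤ r ≤ 3`, is piecewise constant on the cone**: `−64 × #face conditions` equals the sum of `−64 ×` the
indicators of the face polytopes `R_r ∩ {xᵢ = e_a}` (`i < r`, `a ≤ 85`), `R_r ∩ {xᵢ + xⱼ = c₀}`, `R_r ∩ {xᵢ + xⱼ = 1/2}`
(`i < j`) and, for `r = 3`, `R_3 ∩ {|x| = 1/2}`. [cite: FordMaynard2024PrimeSieves, Definition 7.2] -/
theorem coneRep_gFace (r : ℕ) (hr1 : 1 ≤ r) (hr3 : r ≤ 3) :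
    ∃ (m : ℕ) (P : Fin m → Set (Fin r → ℝ)) (c : Fin m → ℝ),
      (∀ j, IsConvexPolytope (P j) ∧ P j ⊆ {x | Monotone x}) ∧
        ∀ x : Fin r → ℝ, Monotone x → gFace r x = ∑ j, if x ∈ P j then c j else 0 := by
  set R : Set (Fin r → ℝ) := {x | Monotone x ∧ (∀ i, (1651 / 10000 : ℝ) < x i) ∧ ∑ i, x i ≤ 1 / 2} with hR
  -- the four blocks of the candidate sum of indicators
  set F₁ : (Fin r → ℝ) → ℝ := fun x =>
    ∑ i : Fin r, ∑ a ∈ Finset.range 86, (if x ∈ R ∩ {y | y i = ((certEdge a : ℚ) : ℝ)} then (-64 : ℝ) else 0)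
    with hF₁
  set F₂ : (Fin r → ℝ) → ℝ := fun x =>
    ∑ q ∈ (Finset.univ : Finset (Fin r × Fin r)).filter (fun q => q.1 < q.2),
      (if x ∈ R ∩ {y | y q.1 + y q.2 = 8349 / 20000} then (-64 : ℝ) else 0) with hF₂
  set F₃ : (Fin r → ℝ) → ℝ := fun x =>
    ∑ q ∈ (Finset.univ : Finset (Fin r × Fin r)).filter (fun q => q.1 < q.2),
      (if x ∈ R ∩ {y | y q.1 + y q.2 = 1 / 2} then (-64 : ℝ) else 0) with hF₃
  set F₄ : (Fin r → ℝ) → ℝ := fun x =>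
    if r = 3 then (if x ∈ R ∩ {y | ∑ i, y i = 1 / 2} then (-64 : ℝ) else 0) else 0 with hF₄
  -- Step A: each block is representable
  have hA₁ : ∃ (m : ℕ) (P : Fin m → Set (Fin r → ℝ)) (c : Fin m → ℝ),
      (∀ j, IsConvexPolytope (P j) ∧ P j ⊆ {x | Monotone x}) ∧
        ∀ x : Fin r → ℝ, Monotone x → F₁ x = ∑ j, if x ∈ P j then c j else 0 := by
    refine coneRep_finset_sum _ _ fun i _ => coneRep_finset_sum _ _ fun a _ => ?_
    obtain ⟨h1, h2⟩ := isConvexPolytope_region_coord r i ((certEdge a : ℚ) : ℝ)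
    exact coneRep_indicator' h1 h2 (-64)
  have hA₂ : ∃ (m : ℕ) (P : Fin m → Set (Fin r → ℝ)) (c : Fin m → ℝ),
      (∀ j, IsConvexPolytope (P j) ∧ P j ⊆ {x | Monotone x}) ∧
        ∀ x : Fin r → ℝ, Monotone x → F₂ x = ∑ j, if x ∈ P j then c j else 0 := by
    refine coneRep_finset_sum _ _ fun q hq => ?_
    have hq' : q.1 ≠ q.2 := (Finset.mem_filter.1 hq).2.ne
    obtain ⟨h1, h2⟩ := isConvexPolytope_region_pair r hq' (8349 / 20000)
    exact coneRep_indicator' h1 h2 (-64)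
  have hA₃ : ∃ (m : ℕ) (P : Fin m → Set (Fin r → ℝ)) (c : Fin m → ℝ),
      (∀ j, IsConvexPolytope (P j) ∧ P j ⊆ {x | Monotone x}) ∧
        ∀ x : Fin r → ℝ, Monotone x → F₃ x = ∑ j, if x ∈ P j then c j else 0 := by
    refine coneRep_finset_sum _ _ fun q hq => ?_
    have hq' : q.1 ≠ q.2 := (Finset.mem_filter.1 hq).2.ne
    obtain ⟨h1, h2⟩ := isConvexPolytope_region_pair r hq' (1 / 2)
    exact coneRep_indicator' h1 h2 (-64)
  have hA₄ : ∃ (m : ℕ) (P : Fin m → Set (Fin r → ℝ)) (c : Fin m → ℝ),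
      (∀ j, IsConvexPolytope (P j) ∧ P j ⊆ {x | Monotone x}) ∧
        ∀ x : Fin r → ℝ, Monotone x → F₄ x = ∑ j, if x ∈ P j then c j else 0 := by
    by_cases h3 : r = 3
    · obtain ⟨h1, h2⟩ := isConvexPolytope_region_total r (1 / 2)
      refine coneRep_congr (f := fun x => if x ∈ R ∩ {y | ∑ i, y i = 1 / 2} then (-64 : ℝ) else 0) ?_
        (coneRep_indicator' h1 h2 (-64))
      intro x _; simp only [hF₄]; rw [if_pos h3]
    · exact coneRep_congr (f := fun _ => (0 : ℝ)) (fun x _ => by simp only [hF₄]; rw [if_neg h3]) (coneRep_zero r)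
  have hA := coneRep_add (coneRep_add (coneRep_add hA₁ hA₂) hA₃) hA₄
  -- Step B: `gFace r = F₁ + F₂ + F₃ + F₄` on the cone (indeed everywhere)
  refine coneRep_congr (fun x hx => ?_) hA
  by_cases hreg : (∀ i, (1651 / 10000 : ℝ) < x i) ∧ ∑ i, x i ≤ 1 / 2
  · have hxR : x ∈ R := ⟨hx, hreg.1, hreg.2⟩
    have hG : gFace r x = -64 * (faceCount r x : ℝ) := by
      unfold gFace; rw [if_pos ⟨hr1, hr3, hx, hreg.1, hreg.2⟩]
    -- block 1: edges
    have hb1 : F₁ x = -64 * ((Finset.univ.filter (fun i : Fin r => x i ∈ edgeSet)).card : ℝ) := by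
      have inner : ∀ i : Fin r, (∑ a ∈ Finset.range 86,
          (if x ∈ R ∩ {y | y i = ((certEdge a : ℚ) : ℝ)} then (-64 : ℝ) else 0)) =
          (if x i ∈ edgeSet then (-64 : ℝ) else 0) := by
        intro i
        by_cases he : x i ∈ edgeSet
        · obtain ⟨a₀, ha₀, hta⟩ := he
          rw [if_pos ⟨a₀, ha₀, hta⟩, Finset.sum_eq_single_of_mem a₀ (Finset.mem_range.2 (by omega))]
          · rw [if_pos (show x ∈ R ∩ {y | y i = ((certEdge a₀ : ℚ) : ℝ)} from ⟨hxR, hta⟩)]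
          · intro a ha hne
            rw [if_neg]
            rintro ⟨-, h⟩
            have ha' : a ≤ 85 := by have := Finset.mem_range.1 ha; omega
            exact hne (certEdge_cast_injOn ha' ha₀ ((Eq.symm h).trans hta))
        · rw [if_neg he]
          refine Finset.sum_eq_zero fun a ha => ?_
          rw [if_neg]
          rintro ⟨-, h⟩
          have ha' : a ≤ 85 := by have := Finset.mem_range.1 ha; omega
          exact he ⟨a, ha', h⟩
      simp only [hF₁]
      rw [Finset.sum_congr rfl fun i _ => inner i, sum_ite_const_eq_card]
    -- blocks 2, 3: pairs
    have hb23 : ∀ s : ℝ, (∑ q ∈ (Finset.univ : Finset (Fin r × Fin r)).filter (fun q => q.1 < q.2),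
        (if x ∈ R ∩ {y | y q.1 + y q.2 = s} then (-64 : ℝ) else 0)) =
        -64 * ((Finset.univ.filter (fun q : Fin r × Fin r => q.1 < q.2 ∧ x q.1 + x q.2 = s)).card : ℝ) := by
      intro s
      have inner : ∀ q : Fin r × Fin r, (if x ∈ R ∩ {y | y q.1 + y q.2 = s} then (-64 : ℝ) else 0) =
          if x q.1 + x q.2 = s then -64 else 0 := by
        intro q
        by_cases h : x q.1 + x q.2 = s
        · rw [if_pos (show x ∈ R ∩ {y | y q.1 + y q.2 = s} from ⟨hxR, h⟩), if_pos h]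
        · rw [if_neg h, if_neg (fun h' => h h'.2)]
      rw [Finset.sum_congr rfl fun q _ => inner q, sum_ite_const_eq_card, Finset.filter_filter]
    have hb2 : F₂ x = -64 * ((Finset.univ.filter
        (fun q : Fin r × Fin r => q.1 < q.2 ∧ x q.1 + x q.2 = 8349 / 20000)).card : ℝ) := by
      simp only [hF₂]; exact hb23 _
    have hb3 : F₃ x = -64 * ((Finset.univ.filter
        (fun q : Fin r × Fin r => q.1 < q.2 ∧ x q.1 + x q.2 = 1 / 2)).card : ℝ) := by
      simp only [hF₃]; exact hb23 _
    -- block 4: the total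
    have hb4 : F₄ x = -64 * ((if r = 3 ∧ ∑ i, x i = 1 / 2 then 1 else 0 : ℕ) : ℝ) := by
      simp only [hF₄]
      by_cases h3 : r = 3
      · rw [if_pos h3]
        by_cases hs : ∑ i, x i = 1 / 2
        · rw [if_pos (show x ∈ R ∩ {y | ∑ i, y i = 1 / 2} from ⟨hxR, hs⟩), if_pos ⟨h3, hs⟩]; norm_num
        · rw [if_neg (fun h => hs h.2), if_neg (fun h => hs h.2)]; norm_num
      · rw [if_neg h3, if_neg (fun h => h3 h.1)]; norm_num
    show F₁ x + F₂ x + F₃ x + F₄ x = gFace r x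
    rw [hG, hb1, hb2, hb3, hb4]
    unfold faceCount
    push_cast
    ring
  · have hG : gFace r x = 0 := by
      unfold gFace; rw [if_neg (by rintro ⟨-, -, -, h1, h2⟩; exact hreg ⟨h1, h2⟩)]
    have hxR : x ∉ R := fun h => hreg ⟨h.2.1, h.2.2⟩
    have hz : ∀ (S : Set (Fin r → ℝ)) (c : ℝ), (if x ∈ R ∩ S then c else 0) = 0 :=
      fun S c => if_neg (fun h => hxR h.1)
    show F₁ x + F₂ x + F₃ x + F₄ x = gFace r x
    rw [hG]
    have h1 : F₁ x = 0 := by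
      simp only [hF₁]; exact Finset.sum_eq_zero fun i _ => Finset.sum_eq_zero fun a _ => hz _ _
    have h2 : F₂ x = 0 := by simp only [hF₂]; exact Finset.sum_eq_zero fun q _ => hz _ _
    have h3 : F₃ x = 0 := by simp only [hF₃]; exact Finset.sum_eq_zero fun q _ => hz _ _
    have h4 : F₄ x = 0 := by
      simp only [hF₄]
      by_cases h : r = 3
      · rw [if_pos h]; exact hz _ _
      · rw [if_neg h]
    rw [h1, h2, h3, h4]; ring

/-! ### The trivial dimensions of `coneCert` -/

/-- `coneCert 0 ≡ 1` is representable (one piece: the trivial polytope `{∅}`). [cite: FordMaynard2024PrimeSieves, Definition 7.2] -/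
theorem coneRep_coneCert_zero :
    ∃ (m : ℕ) (P : Fin m → Set (Fin 0 → ℝ)) (c : Fin m → ℝ),
      (∀ j, IsConvexPolytope (P j) ∧ P j ⊆ {x | Monotone x}) ∧
        ∀ x : Fin 0 → ℝ, Monotone x → coneCert 0 x = ∑ j, if x ∈ P j then c j else 0 := by
  have hU : IsConvexPolytope (Set.univ : Set (Fin 0 → ℝ)) := by
    refine isConvexPolytope_of_constraints (ι₁ := Fin 0) (ι₂ := Fin 0) Fin.elim0 Fin.elim0 Fin.elim0 Fin.elim0
      ?_ fun x => ?_
    · exact (Set.finite_univ_iff.2 inferInstance).isBounded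
    · simp
  have hmono : (Set.univ : Set (Fin 0 → ℝ)) ⊆ {x | Monotone x} := fun x _ => fun a => Fin.elim0 a
  refine coneRep_congr (f := fun x => if x ∈ (Set.univ : Set (Fin 0 → ℝ)) then (1 : ℝ) else 0) ?_
    (coneRep_indicator' hU hmono 1)
  intro x _
  rw [if_pos (Set.mem_univ x), coneCert_empty]

/-- `coneCert 1 = −𝟙[ν₀ < x ≤ 1/2] + gFace 1` is representable. [cite: FordMaynard2024PrimeSieves, Definition 7.2] -/
theorem coneRep_coneCert_one :
    ∃ (m : ℕ) (P : Fin m → Set (Fin 1 → ℝ)) (c : Fin m → ℝ),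
      (∀ j, IsConvexPolytope (P j) ∧ P j ⊆ {x | Monotone x}) ∧
        ∀ x : Fin 1 → ℝ, Monotone x → coneCert 1 x = ∑ j, if x ∈ P j then c j else 0 := by
  set Q : Set (Fin 1 → ℝ) := {x | (1651 / 10000 : ℝ) < x 0 ∧ x 0 ≤ 1 / 2} with hQ
  have hQpoly : IsConvexPolytope Q := by
    refine isConvexPolytope_of_constraints (ι₁ := Fin 1) (ι₂ := Fin 1) (fun _ _ => -1)
      (fun _ => -(1651 / 10000)) (fun _ _ => 1) (fun _ => 1 / 2) ?_ fun x => ?_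
    · refine (Metric.isBounded_Icc (fun _ : Fin 1 => (1651 / 10000 : ℝ)) (fun _ => 1 / 2)).subset ?_
      intro x hx
      have hx' : (1651 / 10000 : ℝ) < x 0 ∧ x 0 ≤ 1 / 2 := hx
      refine ⟨fun i => ?_, fun i => ?_⟩
      · have : i = 0 := Subsingleton.elim _ _
        subst this; exact hx'.1.le
      · have : i = 0 := Subsingleton.elim _ _
        subst this; exact hx'.2
    · simp only [hQ, Set.mem_setOf_eq, Fin.sum_univ_one, Fin.forall_fin_one, Fin.isValue]
      constructor
      · rintro ⟨h1, h2⟩; exact ⟨by linarith, by linarith⟩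
      · rintro ⟨h1, h2⟩; exact ⟨by linarith, by linarith⟩
  have hQmono : Q ⊆ {x | Monotone x} := fun x _ => Subsingleton.monotone x
  refine coneRep_congr (f := fun x => (if x ∈ Q then (-1 : ℝ) else 0) + gFace 1 x) ?_
    (coneRep_add (coneRep_indicator' hQpoly hQmono (-1)) (coneRep_gFace 1 le_rfl (by norm_num)))
  intro x _
  show (if x ∈ Q then (-1 : ℝ) else 0) + gFace 1 x = gTab 1 x + gFace 1 x
  congr 1

/-- `coneCert r ≡ 0` for `r ≥ 4` is representable (no pieces). [cite: FordMaynard2024PrimeSieves, Definition 7.2] -/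
theorem coneRep_coneCert_four_le (n : ℕ) :
    ∃ (m : ℕ) (P : Fin m → Set (Fin (n + 4) → ℝ)) (c : Fin m → ℝ),
      (∀ j, IsConvexPolytope (P j) ∧ P j ⊆ {x | Monotone x}) ∧
        ∀ x : Fin (n + 4) → ℝ, Monotone x → coneCert (n + 4) x = ∑ j, if x ∈ P j then c j else 0 := by
  refine coneRep_congr (f := fun _ => (0 : ℝ)) (fun x _ => ?_) (coneRep_zero (n + 4))
  show (0 : ℝ) = gTab (n + 4) x + gFace (n + 4) x
  have h1 : gTab (n + 4) x = 0 := rfl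
  have h2 : gFace (n + 4) x = 0 := by unfold gFace; rw [if_neg (by omega)]
  rw [h1, h2, add_zero]

end Summit.Parity.GeneralizedHardyLittlewood.FordMaynardSieveConst01651SieveConst01651

end
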